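import Summits.CriticalPhenomena.PercolationContinuityZ3.Theorems.PercNearOneGluingNoHeavyLowerTailSunflowerCoverThree
import Summits.CriticalPhenomena.PercolationContinuityZ3.Theorems.PercNearOneGluingNoHeavyLowerTailSunflowerGradedSafeCNF

/-!
# `NoHeavyLowerTail` (crux stmt-CriticalPhenomena-4575), abstract sunflower cubic: THREE-CLAUSE CORES WITH TWO DISJOINT CLAUSES
# ARE GRADEDLY SAFE — in particular the path core `P₄ = (x₁∨x₃)(x₂∨x₃)(x₂∨x₄)`, the minimal NON-read-once core

Support file (seat `prim-ineq-prove-1` gen 36; `--supports stmt-CriticalPhenomena-4575`).  No `sorry`, no named facts.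
Memo: run/shared/lean/prim/prim-ineq-prove-1/FINDING-COVER-prove1-g36.md §5 (corollary of THEOREM 4).

For a monotone CNF core `A = (⋁X)(⋁Y)(⋁Z) = clauseCore {X, Y, Z}` (three distinct nonempty clauses) with `X` and `Z` DISJOINT, the one
safety inequality of `cover_three` is two Harris inequalities and one independence: `f_Y = P(meet X) P(meet Z)`, so
`f_X f_Y f_Z = [P(meet X) P(meet Y ∧ meet Z)] · [P(meet Z) P(meet X ∧ meet Y)] ≤ h · h`.
* `cover_threeClause` — the cover property of `{X, Y, Z}`;  **`gsafe_threeClause`** — `clauseCore {X,Y,Z}` is GRADEDLY SAFE on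
  `X ∪ Y ∪ Z` (positive probabilities), hence safe (`safe_threeClause`) with all the rows of `…SunflowerSafeCalculus`.
* **`gsafe_P4`** — the path core `{12,23,34} ≅ (x₁∨x₃)(x₂∨x₃)(x₂∨x₄)` (g34's census class `{12,23,14}`: safe numerically, outside every
  earlier calculus; `P₄` is exactly the obstruction to read-once-ness) is gradedly safe.
-/

noncomputable section

namespace Summit.CriticalPhenomena.PercolationContinuityZ3.Theorems.SunflowerPartition

namespace SafeCalc

open MeasureTheory Finset
open Literature.Probability.LatticeModels Literature.Probability.Percolation

variable {ι : Type*} [DecidableEq ι] (p : ι → unitInterval)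

/-- In the family `{X, Y, Z}`, allowing `Y` and `Z` leaves "ω meets X". [this work] -/
theorem hitSet_allow_two {X Y Z : Finset ι} (hXY : X ≠ Y) (hXZ : X ≠ Z) :
    hitSet ({X, Y, Z} : Finset (Finset ι)) {Y, Z} = hitSet {X} ∅ := by
  ext ω
  simp only [hitSet, Set.mem_setOf_eq, mem_insert, mem_singleton, notMem_empty, not_false_iff, forall_true_left,
    forall_eq, not_or]
  constructor
  · intro h
    exact h X (Or.inl rfl) ⟨hXY, hXZ⟩
  · rintro h C (rfl | rfl | rfl) ⟨h1, h2⟩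
    · exact h
    · exact absurd rfl h1
    · exact absurd rfl h2

omit [DecidableEq ι] in
/-- "ω meets X" is determined by `X`. [this work] -/
theorem determinedBy_meet (X : Finset ι) : DeterminedBy (hitSet ({X} : Finset (Finset ι)) ∅) (↑X : Set ι) :=
  determinedBy_hitSet X (𝒯 := {X}) (fun C hC => by rw [mem_singleton] at hC; rw [hC]) ∅

/-- **Independence of disjoint clauses**: in `{X, Y, Z}` with `X ∩ Z = ∅`, `f_{Y} = f_{Y,Z} · f_{X,Y}`
(`P(meet X ∧ meet Z) = P(meet X) P(meet Z)`). [this work] -/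
theorem famIn_middle_eq_mul [Fintype ι] (a : Finset ι) {X Y Z : Finset ι} (hXY : X ≠ Y) (hXZ : X ≠ Z) (hYZ : Y ≠ Z)
    (hdisj : Disjoint X Z) (h𝒯a : ∀ C ∈ ({X, Y, Z} : Finset (Finset ι)), C ⊆ a) :
    famIn p a {X, Y, Z} {Y} = famIn p a {X, Y, Z} {Y, Z} * famIn p a {X, Y, Z} {X, Y} := by
  rw [famIn_eq_real_hitSet p a h𝒯a, famIn_eq_real_hitSet p a h𝒯a, famIn_eq_real_hitSet p a h𝒯a]
  have hYeq : ({Y, Z} : Finset (Finset ι)) ∩ {X, Y} = {Y} := by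
    ext C
    simp only [mem_inter, mem_insert, mem_singleton]
    constructor
    · rintro ⟨h1 | h1, h2 | h2⟩
      · exact h1
      · exact h1
      · exact absurd (h2.symm.trans h1) hXZ
      · exact h2
    · intro h; exact ⟨Or.inl h, Or.inr h⟩
  have hY : hitSet ({X, Y, Z} : Finset (Finset ι)) {Y} = hitSet {X, Y, Z} {Y, Z} ∩ hitSet {X, Y, Z} {X, Y} := by
    rw [hitSet_inter, hYeq]
  have hZX : hitSet ({X, Y, Z} : Finset (Finset ι)) {X, Y} = hitSet {Z} ∅ := by
    have h1 : ({X, Y, Z} : Finset (Finset ι)) = {Z, X, Y} := by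
      ext C; simp only [mem_insert, mem_singleton]; tauto
    rw [h1]
    exact hitSet_allow_two hXZ.symm hYZ.symm
  rw [hY, hitSet_allow_two hXY hXZ, hZX]
  exact prodBernoulli_real_inter_of_determinedBy_disjoint p hdisj (determinedBy_meet X) (determinedBy_meet Z)
    MeasurableSet.of_discrete MeasurableSet.of_discrete

/-- **Three clauses, two of them disjoint: the cover property.** [this work] -/
theorem cover_threeClause [Fintype ι] (a : Finset ι) {X Y Z : Finset ι} (hXY : X ≠ Y) (hXZ : X ≠ Z) (hYZ : Y ≠ Z)
    (hdisj : Disjoint X Z) (h𝒯a : ∀ C ∈ ({X, Y, Z} : Finset (Finset ι)), C ⊆ a) : Cover p a {X, Y, Z} := by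
  refine cover_three p a hXY hXZ hYZ h𝒯a ?_
  have hne : X ≠ Y ∧ X ≠ Z ∧ Y ≠ Z ∧ Y ≠ X ∧ Z ≠ X ∧ Z ≠ Y := ⟨hXY, hXZ, hYZ, hXY.symm, hXZ.symm, hYZ.symm⟩
  have hmem : ∀ C ∈ ({X, Y, Z} : Finset (Finset ι)), C = X ∨ C = Y ∨ C = Z := fun C hC => by simpa using hC
  have merge : ∀ 𝒰 𝒱 𝒲 : Finset (Finset ι), (∀ C ∈ ({X, Y, Z} : Finset (Finset ι)), (C ∈ 𝒰 ∩ 𝒱 ↔ C ∈ 𝒲)) →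
      famIn p a {X, Y, Z} 𝒰 * famIn p a {X, Y, Z} 𝒱 ≤ famIn p a {X, Y, Z} 𝒲 := by
    intro 𝒰 𝒱 𝒲 hW
    rw [← famIn_congr p a {X, Y, Z} hW]
    exact famIn_mul_le_inter p a h𝒯a 𝒰 𝒱
  have P1 : famIn p a {X, Y, Z} {Y, Z} * famIn p a {X, Y, Z} {X} ≤ famIn p a {X, Y, Z} ∅ :=
    merge _ _ _ fun C hC => by rcases hmem C hC with rfl | rfl | rfl <;> simp [hne]
  have P3 : famIn p a {X, Y, Z} {X, Y} * famIn p a {X, Y, Z} {Z} ≤ famIn p a {X, Y, Z} ∅ :=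
    merge _ _ _ fun C hC => by rcases hmem C hC with rfl | rfl | rfl <;> simp [hne]
  have h0 : ∀ 𝒰, 0 ≤ famIn p a {X, Y, Z} 𝒰 := fun 𝒰 => famIn_nonneg p a _ 𝒰
  rw [famIn_middle_eq_mul p a hXY hXZ hYZ hdisj h𝒯a]
  calc famIn p a {X, Y, Z} {X} * (famIn p a {X, Y, Z} {Y, Z} * famIn p a {X, Y, Z} {X, Y}) * famIn p a {X, Y, Z} {Z}
      = (famIn p a {X, Y, Z} {Y, Z} * famIn p a {X, Y, Z} {X}) * (famIn p a {X, Y, Z} {X, Y} * famIn p a {X, Y, Z} {Z}) := by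
        ring
    _ ≤ famIn p a {X, Y, Z} ∅ * famIn p a {X, Y, Z} ∅ :=
        mul_le_mul P1 P3 (mul_nonneg (h0 _) (h0 _)) (h0 _)
    _ = famIn p a {X, Y, Z} ∅ ^ 2 := (sq _).symm

omit [DecidableEq ι] in
/-- A CNF core with nonempty clauses inside the block has positive probability when the block's coordinates do. [this work] -/
theorem real_clauseCore_pos [Fintype ι] (a : Finset ι) (𝒞 : Finset (Finset ι)) (h𝒞a : ∀ C ∈ 𝒞, C ⊆ a)
    (hne : ∀ C ∈ 𝒞, C.Nonempty) (hp : ∀ e ∈ a, 0 < (p e : ℝ)) : 0 < (prodBernoulli p).real (clauseCore 𝒞) :=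
  calc (0 : ℝ) < ∏ e ∈ a, (p e : ℝ) := prod_pos hp
    _ = (prodBernoulli p).real {ω | (↑a : Set ι) ⊆ ω} := (prodBernoulli_real_subset p a).symm
    _ ≤ (prodBernoulli p).real (clauseCore 𝒞) := measureReal_mono fun ω hω C hC => by
        obtain ⟨e, he⟩ := hne C hC
        exact ⟨e, he, hω (Finset.mem_coe.2 (h𝒞a C hC he))⟩

/-- **Three clauses, two of them disjoint ⟹ GRADEDLY SAFE**: the monotone CNF core `clauseCore {X, Y, Z}` with distinct nonempty
clauses `X, Y, Z ⊆ a` and `X ∩ Z = ∅` is gradedly safe on `a`, for positive coordinate probabilities. [this work] -/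
theorem gsafe_threeClause [Fintype ι] (a : Finset ι) {X Y Z : Finset ι} (hXY : X ≠ Y) (hXZ : X ≠ Z) (hYZ : Y ≠ Z)
    (hdisj : Disjoint X Z) (hX : X.Nonempty) (hY : Y.Nonempty) (hZ : Z.Nonempty)
    (ha : ({X, Y, Z} : Finset (Finset ι)).biUnion id = a) (hp : ∀ e ∈ a, 0 < (p e : ℝ)) :
    GSafe p a (clauseCore {X, Y, Z}) := by
  have h𝒯a : ∀ C ∈ ({X, Y, Z} : Finset (Finset ι)), C ⊆ a := by
    intro C hC; rw [← ha]; exact subset_biUnion_of_mem id hC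
  have hne : ∀ C ∈ ({X, Y, Z} : Finset (Finset ι)), C.Nonempty := by
    intro C hC
    simp only [mem_insert, mem_singleton] at hC
    rcases hC with rfl | rfl | rfl
    exacts [hX, hY, hZ]
  have hd : DeterminedBy (clauseCore ({X, Y, Z} : Finset (Finset ι))) (↑a : Set ι) := by
    rw [← ha]; exact determinedBy_clauseCore _
  refine gsafe_of_cover p a hd (isUpperSet_clauseCore _) (real_clauseCore_pos p a _ h𝒯a hne hp) {X, Y, Z} h𝒯a
    (fun C hC => ?_) (fun T hT hbad => ?_) (cover_threeClause p a hXY hXZ hYZ hdisj h𝒯a)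
  · rw [← ha, sdiff_mem_clauseCore_iff]
    exact fun h => h C hC subset_rfl
  · rw [← ha, sdiff_mem_clauseCore_iff] at hbad
    push Not at hbad
    exact hbad

/-- … hence SAFE (`∏ μ(V i) ≤ μ(A)^(n−1)` for up-sets meeting pairwise inside it). [this work] -/
theorem safe_threeClause [Fintype ι] (a : Finset ι) {X Y Z : Finset ι} (hXY : X ≠ Y) (hXZ : X ≠ Z) (hYZ : Y ≠ Z)
    (hdisj : Disjoint X Z) (hX : X.Nonempty) (hY : Y.Nonempty) (hZ : Z.Nonempty)
    (ha : ({X, Y, Z} : Finset (Finset ι)).biUnion id = a) (hp : ∀ e ∈ a, 0 < (p e : ℝ)) :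
    Safe p (clauseCore {X, Y, Z}) := by
  have hd : DeterminedBy (clauseCore ({X, Y, Z} : Finset (Finset ι))) (↑a : Set ι) := by
    rw [← ha]; exact determinedBy_clauseCore _
  exact safe_of_gsafe p a hd (isUpperSet_clauseCore _) (gsafe_threeClause p a hXY hXZ hYZ hdisj hX hY hZ ha hp)

/-! ## The path core `P₄` -/

/-- **The path core `P₄ = (x₁∨x₃)(x₂∨x₃)(x₂∨x₄)` (`= {12, 23, 34}` as an up-set of the path `1–2–3–4`, the minimal non-read-once
core) is GRADEDLY SAFE**, for every product measure with positive probabilities on `{1,2,3,4}`. [this work] -/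
theorem gsafe_P4 (q : Fin 5 → unitInterval) (hq : ∀ e ∈ ({1, 2, 3, 4} : Finset (Fin 5)), 0 < (q e : ℝ)) :
    GSafe q {1, 2, 3, 4} (clauseCore ({{1, 3}, {2, 3}, {2, 4}} : Finset (Finset (Fin 5)))) :=
  gsafe_threeClause q {1, 2, 3, 4} (by decide) (by decide) (by decide) (by decide) (by decide) (by decide) (by decide)
    (by decide) hq

/-- … and SAFE. [this work] -/
theorem safe_P4 (q : Fin 5 → unitInterval) (hq : ∀ e ∈ ({1, 2, 3, 4} : Finset (Fin 5)), 0 < (q e : ℝ)) :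
    Safe q (clauseCore ({{1, 3}, {2, 3}, {2, 4}} : Finset (Finset (Fin 5)))) :=
  safe_threeClause q {1, 2, 3, 4} (by decide) (by decide) (by decide) (by decide) (by decide) (by decide) (by decide)
    (by decide) hq

end SafeCalc

end Summit.CriticalPhenomena.PercolationContinuityZ3.Theorems.SunflowerPartition
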